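import Summits.BirchSwinnertonDyer.Rank1Residual.X11b.CastellaErratum
import Literature.NumberTheory.EllipticCurves.BSDQuadraticDescentShaOddPartGeneralProofs
import Literature.NumberTheory.EllipticCurves.Skinner2016.RankZeroPPart
import Literature.NumberTheory.EllipticCurves.GrossZagierRationalPoint
import Literature.NumberTheory.EllipticCurves.ModularityVersionApProofs
import HarnessLib

/-!
# X11b, route R1 — "the same argument as in [Cas18, §5]", kernel-checked in the erratum's setting

HONEST FRAMING (cell `b2b-bsdres`, verbatim): the goal of the cell is to DELETE the
COMBINATION-SHAPED residual classes for ALL analytic-rank `≤ 1` curves over `ℚ` — "full BSD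
formula for every rank `≤ 1` curve in class C" assembled STRICTLY from published theorems — so that
the rank-`≤ 1` remainder becomes exactly the CONSTRUCTION-SHAPED classes, which are TYPED
(missing-input `Prop`s), NOT attempted. This is not "finishing BSD". Sub-cell `b2b-bsdres-multr1-p1`,
research route R1 for X11b (Castella 2018 Thm. A re-proved along the author's erratum): a RESEARCH
ROUTE, no claim beyond the stated class; the theorems below are CONDITIONAL on their listed inputs,
exactly one of which is unrefereed (the display (A), carrying the erratum's Thm. 1.1 ⇐ Fouquet–Wan
arXiv:2107.13726 Thm. 4.41), and delete nothing.

## What this file proves (no `def`, no named fact, nothing asserted)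

Castella's erratum (p. 1) says: "Using Theorem 1.1 in place of [Cas18, Thm. 4.4], the same argument
as in [Cas18, § 5] yields … Theorem A′", now "allowing `E` to have primes of additive reduction" —
but §5 of Camb. J. Math. 6 (2018) is printed for SEMISTABLE `E` and the erratum does not write the
argument out. This file IS that argument, run in the kernel on the per-pair link shapes of
`CastellaErratum.lean`, for arbitrary conductor:

* `padicVal_printShape_of_links` — the valuation bookkeeping of §5 (arXiv:1704.06608 p. 12, from
  eq. (5.3) to the end): display (A) `ord_p #Ш(E/K)[p^∞] = 2 ord_p [E(K):ℤP] − ord_p ∏_w c_w(E/K)`,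
  GZ paraphrase (B) `ord_p q + ord_p q_D = 2 ord_p [E(K):ℤP]`, Tamagawa relation (C), the PROVED
  tree theorem `Ш(E/K)[p^∞] = Ш(E)[p^∞] ⊕ Ш(E^D)[p^∞]` (orders, odd `p`;
  `card_primaryComponent_sha_baseChange_quadratic_of_odd_of_finite`) and the rank-`0` print shape of
  the twist `PPartRankZero Wd p` give the A′-shape
  `ord_p(L'(E,1)/(Ω_E Reg)) = ord_p #Ш(E) + ord_p ∏ c_ℓ(E)` — for ANY `E` (no semistability), with
  the rationality `L'(E,1)/(Ω Reg) ∈ ℚ` from Gross–Zagier 1986 Thm. I.7.3 (`hGZ`) and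
  `rank E(ℚ) = 1`, `Ш` finite from Gross–Zagier–Kolyvagin (`hGZK`). The torsion term of the twist's
  print shape is killed by `irr(p)` for `E^D` (Mazur).
* `bsdp_of_links` — adds the rank-`0` input for `E^D` AS PRINTED: Skinner, Pacific J. Math. 283
  (2016) Thm. C (`Skinner2016.thmC_padicValRat_bsd_rank_zero`, PUB), whose hypotheses for `E^D` are
  multiplicative reduction at `p`, `E^D[p]` irreducible, and a (ram) witness `ℓ ≠ p` — the SECOND
  ramified multiplicative prime of `E` (cell flag `CAS18-ERR-ram2`; `E^D` is additive at the ramified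
  `q`) —, `L(E^D,1) ≠ 0`, `Ш(E^D)` finite (GZK at rank `0`); concludes Miller's `BSD(E,p)` through
  the tree bridge `bsdp_of_padicVal_printShape`.
* `routeGoal_of_links` — the route target `RouteGoal` (every rank-one pair of `ChainLocus` satisfies
  `BSD(E,p)`) from: the three named facts above (PUB), the PROVED tree theorems (global minimal
  models, `p ∣ N_E ⟺` bad reduction, `Ш` decomposition, model invariance of `L`), and SIX `∀`-form
  hypotheses written out in the signature, each the universal closure of a per-pair shape of
  `CastellaErratum.lean` over the erratum's setting, with status:
  - `hField` (supply of the field `K` of §5: `q` ramified, all other `ℓ ∣ N` split, `2` split if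
    `2 ∤ N`, `L(E^D,1) ≠ 0`) — PUB: Friedberg–Hoffstein, Ann. of Math. 142 (1995) Thm. B for the
    quadratic twists of `f_E` with prescribed local behaviour at the finitely many primes of `2N`,
    given that the sign is `+1`, which it is: `w(E) = −1` (`r_an = 1`) and `w(E/K) = −1` under the
    generalized Heegner hypothesis (Gross–Zagier 1986 / Gross 1984), so `w(E^D) = +1`; used without
    comment by Cas18 §5 ("Choose an imaginary quadratic field …").
  - `hHeeg` (a Heegner point `P ∈ E(K)` of level `N_E` of infinite order) — PUB: Gross 1984 §3
    (Heegner points on `X₀(N)` over `K` exist iff `d_K ≡ β² (mod 4N)`, here with `q ∣ (N, d_K)`,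
    `q ∥ N`), Yuan–Zhang–Zhang 2013 Thm. 1.2 / Cai–Shu–Tian 2014 Thm. 1.1 (`ĥ(P) ≠ 0 ⟺
    L'(E/K,1) ≠ 0`), Artin formalism `L(E/K,s) = L(E,s)L(E^D,s)`; Cas18 §5: "`P_K` has infinite
    order … by the work of Gross–Zagier and Kolyvagin". (The tree's `gross_zagier`,
    `exists_isHeegnerPoint`, `kolyvagin` are stated under the ALL-SPLIT Heegner hypothesis and do not
    apply to this `K`; hence a hypothesis here.)
  - `hA` — OPEN ∘ PUB: the display `Display53At` (⇐ erratum Thm. 1.1 [unrefereed ⇐ Fouquet–Wan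
    Thm. 4.41 unrefereed] + Cas18 Thm. 2.3 + Thm. 3.2 + GZK + W. Zhang 2014 on `c_w` at `w ∣ q`).
    THE ONE OPEN INPUT.
  - `hB` — PUB for semistable `E` (Cas18 §5 display with footnote 2 ⇐ GZ86/YZZ13/CST14 + period
    relation); for non-semistable `E` only the erratum's "same argument" (its ingredients are
    published and insensitive to additive primes away from `pD`, but no refereed text prints it).
  - `hC` — PUB, elementary (Cas18 §5 "immediate relation"; CGLS 2022 (5.6); Kodaira–Néron).
  - `hT` — elementary (Silverman AEC X.5.4: `E^D ≅ E` over `ℚ_ℓ` at `ℓ` split in `K`; VII.5.1).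
  So `RouteGoal` holds modulo {FW21 Thm. 4.41 / the erratum's Thm. 1.1} and published theorems, on
  exactly the population `ChainLocus` = A′-hypotheses ∧ (ram2); and the proof SHOWS where (ram2),
  `irr`, `E(ℚ_p)[p] = 0` (inside (A)) and the nonsplit condition at `q` (inside (A), erratum (iii))
  are consumed. Which (E,p) of X11b this settles: see `CastellaErratum.lean` (census: 5/12 `T-CAS`,
  1/10 residue pairs `N < 10⁴` at `p ≥ 5`; the complement of `ChainLocus` in X11b — `p = 3`, no
  nonsplit ramified `q`, `E(ℚ_p)[p] ≠ 0`, or no second ramified prime — is NOT reached by R1).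
-/

noncomputable section

open scoped Classical

open WeierstrassCurve NumberField Literature.NumberTheory.EllipticCurves
  Literature.NumberTheory.EllipticCurves.Rank1Residual
  Literature.NumberTheory.EllipticCurves.Rank1Residual.Typed

namespace Summit.BirchSwinnertonDyer.Rank1Residual.X11b

section Chain

variable (W : WeierstrassCurve ℚ) [W.IsElliptic] [W.IsGloballyMinimal] (p : ℕ) [Fact p.Prime]

variable {W p} in
omit [W.IsGloballyMinimal] in
/-- On an erratum field every multiplicative prime `ℓ ≠ q` of `E` splits: `ℓ ∣ N_E` by the PROVED
dictionary `dvd_conductorNorm_iff_not_hasGoodReductionAtPrime` (Diamond–Shurman §8.3), and the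
field splits every `ℓ ∣ N_E` other than `q`. [folklore] -/
theorem IsErratumField.splitsIn_of_mult {K : Type} [Field K] [NumberField K] {q : ℕ}
    (hK : IsErratumField W K q) {ℓ : ℕ} [Fact ℓ.Prime] (hℓ : Mult W ℓ) (hℓq : ℓ ≠ q) :
    SplitsIn K ℓ :=
  hK.2.2.1 ℓ Fact.out ((W.dvd_conductorNorm_iff_not_hasGoodReductionAtPrime ℓ).mpr
    (WeierstrassCurve.HasMultiplicativeReduction.not_hasGoodReduction (R := ℤ_[ℓ]) hℓ)) hℓq

omit [W.IsGloballyMinimal] in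
/-- **Castella §5, from eq. (5.3) to the A′-shape, kernel-checked for arbitrary conductor.** Let
`W/ℚ` be elliptic with `ord_{s=1} L(E,s) = 1`, `p` an odd prime, `K` imaginary quadratic, `Wd` a
globally minimal model of the twist `E^{(d_K)}` with `E^{(d_K)}[p]` irreducible, `L(E^{(d_K)},1) ≠ 0`
and the rank-`0` print shape `PPartRankZero Wd p`, and `P ∈ E(K)`. If the display (A)
`Display53At W p K P`, the Gross–Zagier paraphrase (B) `GZParaphraseAt W p K P Wd` and the Tamagawa
relation (C) `TamagawaDescentAt W p K Wd` hold, then `L'(E,1)/(Ω_E·Reg(E/ℚ))` is a rational `q`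
with `ord_p q = ord_p #Ш(E/ℚ) + ord_p ∏_ℓ c_ℓ(E/ℚ)` (the display of Thm. A′). Inputs: Gross–Zagier
1986 Thm. I.7.3 (`hGZ`, rationality), Gross–Zagier–Kolyvagin (`hGZK`: `rank E(ℚ) = 1`, `Ш(E)` and
`Ш(E^D)` finite), the PROVED `Ш(E/K)[p^∞] = Ш(E)[p^∞]·Ш(E^D)[p^∞]` and Mazur's torsion bound via
`irr` (`padicValNat_torsionOrder_eq_zero_of_irreducible`). The computation (arXiv:1704.06608 p. 12):
`ord_p Ш(E) + ord_p Ш(E^D) = ord_p Ш(E/K) = 2 ord_p[E(K):ℤP] − ord_p ∏c(E) − ord_p ∏c(E^D)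
= ord_p q + ord_p q_D − ord_p ∏c(E) − ord_p ∏c(E^D)` and `ord_p q_D = ord_p Ш(E^D) + ord_p ∏c(E^D)`.
[cite: Castella2018, §5 (arXiv:1704.06608 p. 12), eqs. (5.3) to the end] -/
theorem padicVal_printShape_of_links
    (hGZ : GrossZagier1986_thm_I_7_3) (hGZK : rank_eq_analyticRank_of_analyticRank_le_one)
    (hp : p ≠ 2) (hr : W.analyticRank = 1)
    (K : Type) [Field K] [NumberField K] (hK : IsImaginaryQuadratic K)
    (Wd : WeierstrassCurve ℚ) [Wd.IsElliptic] [Wd.IsGloballyMinimal]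
    (hWd : ∃ C : VariableChange ℚ, C • W.quadraticTwist (NumberField.discr K : ℚ) = Wd)
    (hirrd : Irr Wd p) (hLd : Wd.entireLFunction 1 ≠ 0) (hD : PPartRankZero Wd p)
    (P : (W.baseChange K).toAffine.Point)
    (hA : Display53At W p K P) (hB : GZParaphraseAt W p K P Wd) (hC : TamagawaDescentAt W p K Wd) :
    ∃ q : ℚ, W.leadingLCoeff / ((W.realPeriodRat * W.regulator : ℝ) : ℂ) = (q : ℂ) ∧
      padicValRat p q = (padicValNat p W.shaOrder : ℤ) + padicValNat p W.tamagawaProduct := by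
  obtain ⟨hrank, hfin⟩ := hGZK W (le_of_eq hr)
  have hrk : W.mordellWeilRank = 1 := by omega
  obtain ⟨q, -, hqL⟩ := leadingLCoeff_eq_rat_mul_of_analyticRank_eq_one (W := W) hGZ hr hrk
  have hΩ : (0 : ℝ) < W.realPeriodRat := W.realPeriodRat_pos_holds
  have hR : (0 : ℝ) < W.regulator := W.regulator_pos'
  have hΩR : ((W.realPeriodRat * W.regulator : ℝ) : ℂ) ≠ 0 := by
    exact_mod_cast (mul_pos hΩ hR).ne'
  have hq : W.leadingLCoeff / ((W.realPeriodRat * W.regulator : ℝ) : ℂ) = (q : ℂ) := by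
    rw [div_eq_iff hΩR, hqL]
    push_cast
    ring
  obtain ⟨qd, hqd, hvd⟩ := hD
  have hrd : Wd.analyticRank = 0 :=
    Literature.NumberTheory.EllipticCurves.analyticRank_eq_zero_of_entireLFunction_one_ne_zero Wd hLd
  obtain ⟨-, hfind⟩ := hGZK Wd (by omega)
  haveI : Finite W.sha := hfin
  haveI : Finite Wd.sha := hfind
  haveI : Finite (AddCommGroup.primaryComponent W.sha p) :=
    Finite.of_injective _ Subtype.val_injective
  haveI : Finite (AddCommGroup.primaryComponent Wd.sha p) :=
    Finite.of_injective _ Subtype.val_injective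
  have htorsd : padicValNat p Wd.torsionOrder = 0 :=
    padicValNat_torsionOrder_eq_zero_of_irreducible Wd p hirrd
  -- `#Ш(E/K)[p^∞] = #Ш(E)[p^∞] · #Ш(E^D)[p^∞]` (PROVED tree theorem, odd `p`)
  haveI : (W.baseChange K).IsElliptic := by rw [WeierstrassCurve.baseChange]; infer_instance
  have hdec := W.card_primaryComponent_sha_baseChange_quadratic_of_odd_of_finite K hK.1 Wd hWd
    (W.baseChange K) ⟨1, one_smul _ _⟩ p hp
  have hShaK : padicValNat p (Nat.card (AddCommGroup.primaryComponent (W.baseChange K).sha p)) =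
      padicValNat p W.shaOrder + padicValNat p Wd.shaOrder := by
    rw [hdec, padicValNat.mul (Nat.card_pos).ne' (Nat.card_pos).ne',
      padicValNat_card_addPrimaryComponent, padicValNat_card_addPrimaryComponent]
    rfl
  have hBv := hB q qd hq hqd
  refine ⟨q, hq, ?_⟩
  unfold Display53At at hA
  unfold TamagawaDescentAt at hC
  have hC' : (padicValNat p (W.baseChange K).tamagawaProduct : ℤ) =
      padicValNat p W.tamagawaProduct + padicValNat p Wd.tamagawaProduct := by exact_mod_cast hC
  have hS' : (padicValNat p (Nat.card (AddCommGroup.primaryComponent (W.baseChange K).sha p)) : ℤ)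
      = padicValNat p W.shaOrder + padicValNat p Wd.shaOrder := by exact_mod_cast hShaK
  have ht' : (padicValNat p Wd.torsionOrder : ℤ) = 0 := by exact_mod_cast htorsd
  linarith

omit [W.IsGloballyMinimal] in
/-- **Castella §5 in the erratum's setting, per pair: links ⟹ `BSD(E,p)`.** As
`padicVal_printShape_of_links`, with the rank-`0` print shape of the twist now TAKEN FROM PRINT:
Skinner, Pacific J. Math. 283 (2016) Thm. C (`hSk`, PUB named fact) applied to `Wd` at the
multiplicative prime `p ≥ 5` — hypotheses: `Wd` multiplicative at `p` (`hmultd`), `E^D[p]`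
irreducible (`hirrd`), a multiplicative prime `ℓ ≠ p` of `Wd` with `p ∤ v_ℓ(Δ_min(Wd))` (`hramd` —
the SECOND ramified multiplicative prime of `E`, since `E^D` is additive at the ramified `q`: cell
flag `CAS18-ERR-ram2`), `L(E^D,1) ≠ 0` (`hLd`), `Ш(E^D)` finite (GZK at rank `0`). Conclusion
Miller's `BSD(E,p)` via the tree bridge `bsdp_of_padicVal_printShape` (needs `irr(p)` for `E`).
Cas18 §5, last sentence: "since `L(E^D,1) ≠ 0`, by the known `p`-part of the Birch and
Swinnerton-Dyer formula for `E^D` (as recalled in [JSW]) we arrive at [the A′ display]".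
[cite: Castella2018, §5 (arXiv:1704.06608 p. 12), last step] [cite: Skinner2016PacificMC, Thm. C] -/
theorem bsdp_of_links
    (hGZ : GrossZagier1986_thm_I_7_3) (hGZK : rank_eq_analyticRank_of_analyticRank_le_one)
    (hSk : Skinner2016.thmC_padicValRat_bsd_rank_zero)
    (hp : 5 ≤ p) (hirr : Irr W p) (hr : W.analyticRank = 1)
    (K : Type) [Field K] [NumberField K] (hK : IsImaginaryQuadratic K)
    (Wd : WeierstrassCurve ℚ) [Wd.IsElliptic] [Wd.IsGloballyMinimal]
    (hWd : ∃ C : VariableChange ℚ, C • W.quadraticTwist (NumberField.discr K : ℚ) = Wd)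
    (hLd : Wd.entireLFunction 1 ≠ 0) (hmultd : Mult Wd p) (hirrd : Irr Wd p)
    (hramd : ∃ (ℓ : ℕ) (_ : Fact ℓ.Prime), ℓ ≠ p ∧ Mult Wd ℓ ∧
      ¬ p ∣ padicValInt ℓ Wd.minimalDiscriminantInt)
    (P : (W.baseChange K).toAffine.Point)
    (hA : Display53At W p K P) (hB : GZParaphraseAt W p K P Wd) (hC : TamagawaDescentAt W p K Wd) :
    BSDp W p := by
  have hrd : Wd.analyticRank = 0 :=
    Literature.NumberTheory.EllipticCurves.analyticRank_eq_zero_of_entireLFunction_one_ne_zero Wd hLd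
  obtain ⟨-, hfind⟩ := hGZK Wd (by omega)
  have hD : PPartRankZero Wd p := hSk Wd p (by omega) (Or.inr hmultd) hirrd hramd hLd hfind
  exact bsdp_of_padicVal_printShape W p hGZK (le_of_eq hr) hirr
    (padicVal_printShape_of_links W p hGZ hGZK (by omega) hr K hK Wd hWd hirrd hLd hD P hA hB hC)

end Chain

/-! ### The route theorem -/

/-- **Route R1 assembled: `RouteGoal` (every rank-one pair of `ChainLocus` satisfies `BSD(E,p)`)
from published named facts, proved tree theorems, and six `∀`-form links — exactly one of them
open.** Inputs and status (details in the module docstring): `hGZ` Gross–Zagier 1986 Thm. I.7.3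
(PUB); `hGZK` Gross–Zagier–Kolyvagin (PUB); `hSk` Skinner 2016 Thm. C (PUB); `hField` field supply
(PUB: Friedberg–Hoffstein 1995 Thm. B + sign); `hHeeg` Heegner point of infinite order on the
erratum field (PUB: Gross 1984, YZZ 2013 / CST 2014); `hA` the display (5.3) — OPEN ∘ PUB (erratum
Thm. 1.1 ⇐ Fouquet–Wan Thm. 4.41, both unrefereed; Cas18 Thms. 2.3, 3.2); `hB` GZ paraphrase (PUB
for semistable `E`; erratum's "same argument" otherwise); `hC` Tamagawa relation (PUB, elementary);
`hT` twist transport (elementary). Proof = Cas18 §5 as printed: take the nonsplit ramified `q` and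
the second ramified `ℓ` from `ChainLocus`, the field `K` from `hField`, the Heegner point from
`hHeeg`, a globally minimal model `Wd` of `E^{(d_K)}` (`hasGlobalMinimalModel_rat_holds`, PROVED);
`p` and `ℓ` split in `K` (`IsErratumField.splitsIn_of_mult`), so `Wd` is multiplicative at `p`,
irreducible at `p`, and `ℓ` is a (ram) witness for `Wd` (`hT`); `L(E^D,1) ≠ 0` transfers to `Wd`
(`entireLFunction_smul`, PROVED); conclude by `bsdp_of_links`. CONDITIONAL; deletes nothing.
[cite: Castella2018, §5 (arXiv:1704.06608 p. 12)] [cite: Castella2018Erratum, Thm. A′ and "the same argument as in [Cas18, §5]" (p. 1)] -/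
theorem routeGoal_of_links
    (hGZ : GrossZagier1986_thm_I_7_3) (hGZK : rank_eq_analyticRank_of_analyticRank_le_one)
    (hSk : Skinner2016.thmC_padicValRat_bsd_rank_zero)
    (hField : ∀ (W : WeierstrassCurve ℚ) [W.IsElliptic] [W.IsGloballyMinimal] (p : ℕ) [Fact p.Prime]
        (q : ℕ) [Fact q.Prime], ErratumHypotheses W p → W.analyticRank = 1 → q ≠ p → Mult W q →
        ¬ W.HasSplitMultiplicativeReductionAtPrime q → ¬ p ∣ padicValInt q W.minimalDiscriminantInt →
        ∃ (K : Type) (_ : Field K) (_ : NumberField K), IsErratumField W K q)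
    (hHeeg : ∀ (W : WeierstrassCurve ℚ) [W.IsElliptic] [W.IsGloballyMinimal] [NeZero (W.conductorNorm ℤ)]
        (p : ℕ) [Fact p.Prime] (q : ℕ) [Fact q.Prime] (K : Type) [Field K] [NumberField K],
        ErratumHypotheses W p → W.analyticRank = 1 → Mult W q →
        ¬ W.HasSplitMultiplicativeReductionAtPrime q → IsErratumField W K q →
        ∃ P : (W.baseChange K).toAffine.Point,
          IsHeegnerPoint (W.conductorNorm ℤ) W K P ∧ ¬ IsOfFinAddOrder P)
    (hA : ∀ (W : WeierstrassCurve ℚ) [W.IsElliptic] [W.IsGloballyMinimal] [NeZero (W.conductorNorm ℤ)]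
        (p : ℕ) [Fact p.Prime] (q : ℕ) [Fact q.Prime] (K : Type) [Field K] [NumberField K]
        (P : (W.baseChange K).toAffine.Point),
        ErratumHypotheses W p → W.analyticRank = 1 → q ≠ p → Mult W q →
        ¬ W.HasSplitMultiplicativeReductionAtPrime q → ¬ p ∣ padicValInt q W.minimalDiscriminantInt →
        IsErratumField W K q → IsHeegnerPoint (W.conductorNorm ℤ) W K P → ¬ IsOfFinAddOrder P →
        Display53At W p K P)
    (hB : ∀ (W : WeierstrassCurve ℚ) [W.IsElliptic] [W.IsGloballyMinimal] [NeZero (W.conductorNorm ℤ)]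
        (p : ℕ) [Fact p.Prime] (q : ℕ) [Fact q.Prime] (K : Type) [Field K] [NumberField K]
        (P : (W.baseChange K).toAffine.Point) (Wd : WeierstrassCurve ℚ) [Wd.IsElliptic]
        [Wd.IsGloballyMinimal],
        ErratumHypotheses W p → W.analyticRank = 1 → Mult W q →
        ¬ W.HasSplitMultiplicativeReductionAtPrime q → IsErratumField W K q →
        IsHeegnerPoint (W.conductorNorm ℤ) W K P → ¬ IsOfFinAddOrder P →
        (∃ C : VariableChange ℚ, C • W.quadraticTwist (NumberField.discr K : ℚ) = Wd) →
        GZParaphraseAt W p K P Wd)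
    (hC : ∀ (W : WeierstrassCurve ℚ) [W.IsElliptic] [W.IsGloballyMinimal] (p : ℕ) [Fact p.Prime]
        (q : ℕ) [Fact q.Prime] (K : Type) [Field K] [NumberField K] (Wd : WeierstrassCurve ℚ)
        [Wd.IsElliptic] [Wd.IsGloballyMinimal],
        ErratumHypotheses W p → Mult W q → ¬ W.HasSplitMultiplicativeReductionAtPrime q →
        ¬ p ∣ padicValInt q W.minimalDiscriminantInt → IsErratumField W K q →
        (∃ C : VariableChange ℚ, C • W.quadraticTwist (NumberField.discr K : ℚ) = Wd) →
        TamagawaDescentAt W p K Wd)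
    (hT : ∀ (W : WeierstrassCurve ℚ) [W.IsElliptic] [W.IsGloballyMinimal] (p : ℕ) [Fact p.Prime]
        (K : Type) [Field K] [NumberField K] (Wd : WeierstrassCurve ℚ) [Wd.IsElliptic]
        [Wd.IsGloballyMinimal], IsImaginaryQuadratic K →
        (∃ C : VariableChange ℚ, C • W.quadraticTwist (NumberField.discr K : ℚ) = Wd) →
        TwistTransportAt W p K Wd) :
    RouteGoal := by
  intro W _ _ p _ hCL hr
  have hE : ErratumHypotheses W p := hCL.erratumHypotheses
  obtain ⟨⟨q, hqF, ℓ, hℓF, hqp, hℓp, hℓq, hmq, hnsq, hvq, hmℓ, hvℓ⟩, -⟩ := hCL.2.2.2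
  haveI : NeZero (W.conductorNorm ℤ) := ⟨(W.conductorNorm_pos_holds).ne'⟩
  -- the field of §5, its Heegner point, and a globally minimal model of the twist
  obtain ⟨K, _, _, hKf⟩ := hField W p q hE hr hqp hmq hnsq hvq
  obtain ⟨P, hP, hnt⟩ := hHeeg W p q K hE hr hmq hnsq hKf
  have hd0 : (NumberField.discr K : ℚ) ≠ 0 := by exact_mod_cast NumberField.discr_ne_zero K
  haveI := W.isElliptic_quadraticTwist hd0
  obtain ⟨C, hCmin⟩ := hasGlobalMinimalModel_rat_holds (W.quadraticTwist (NumberField.discr K : ℚ))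
  set Wd := C • W.quadraticTwist (NumberField.discr K : ℚ) with hWd_def
  haveI : Wd.IsGloballyMinimal := hCmin
  have hWd : ∃ C' : VariableChange ℚ, C' • W.quadraticTwist (NumberField.discr K : ℚ) = Wd :=
    ⟨C, rfl⟩
  -- transports along the twist: `p` and the second ramified prime `ℓ` split in `K`
  obtain ⟨htm, hti, htr⟩ := hT W p K Wd hKf.1 hWd
  have hsp : SplitsIn K p := hKf.splitsIn_of_mult hE.2.1 (Ne.symm hqp)
  have hsℓ : SplitsIn K ℓ := hKf.splitsIn_of_mult hmℓ hℓq
  have hmultd : Mult Wd p := htm hsp hE.2.1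
  have hirrd : Irr Wd p := hti hE.2.2.1
  obtain ⟨hmℓd, hvℓd⟩ := htr ℓ hℓp hsℓ hmℓ hvℓ
  have hLd : Wd.entireLFunction 1 ≠ 0 := by
    rw [hWd_def, WeierstrassCurve.entireLFunction_smul]
    exact hKf.2.2.2.2
  exact bsdp_of_links W p hGZ hGZK hSk hE.1 hE.2.2.1 hr K hKf.1 Wd hWd hLd hmultd hirrd
    ⟨ℓ, hℓF, hℓp, hmℓd, hvℓd⟩ P (hA W p q K P hE hr hqp hmq hnsq hvq hKf hP hnt)
    (hB W p q K P Wd hE hr hmq hnsq hKf hP hnt hWd) (hC W p q K Wd hE hmq hnsq hvq hKf hWd)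

end Summit.BirchSwinnertonDyer.Rank1Residual.X11b

end
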